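import Summits.KontsevichZagierPeriods.KontsevichZagierPeriods.Theorems.LinRedNormalFormArrangementNormalFormSeparateTwoMass

/-!
# Measurability of literal Janus band integrands; integrability from the fibre mass

(Line `janus-bands`, crux `ArrangementNormalForm`, stub `stub_separateTwo`, part `Meas`.)
Complements part `Mass`: the literal domain `SepTwo.fdom Y lo hi` is measurable for measurable
`Y` (`measurableSet_fdom`), the literal letter block is measurable (`measurable_rblock`), a
candidate integrand that agrees with `R(base) · rblock` on the domain is a.e. strongly measurable
there (`aestronglyMeasurable_of_eqOn_fdom`), hence ABSOLUTELY INTEGRABLE as soon as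
`∫⁻_Y |R| · lmass < ∞` (`integrableOn_of_lintegral_lt_top`, registered as `separateTwo_meas`).
This is the form in which the Taylor pieces of `separatePos_split` become `KZ.IntegralRep`s in
the roadmap of `stub_separateTwo` (their `integrableOn` field), once the fibre-mass comparisons
bound the base integral.
-/

noncomputable section

open Set MeasureTheory
open scoped ENNReal

namespace Summit.KontsevichZagierPeriods.ArrangementNormalForm.JanusBands

namespace SepTwo

open Literature.NumberTheory.Transcendental

variable {B k : ℕ}

/-- The literal domain is measurable. -/
theorem measurableSet_fdom {Y : Set (Fin B → ℝ)} (hY : MeasurableSet Y)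
    (lo hi : Fin k → Fin k ⊕ Atm B) : MeasurableSet (fdom Y lo hi : Set (Fin (B + k) → ℝ)) := by
  have h := (measurableSet_pdom hY lo hi).preimage (KZ.appendMeasurableEquiv B k).symm.measurable
  convert h using 1
  ext z
  simp only [fdom, mem_setOf_eq, mem_preimage, KZ.appendMeasurableEquiv_symm_apply]
  exact Iff.rfl

/-- The base point is a measurable function of `z`. -/
theorem measurable_basePt : Measurable (basePt : (Fin (B + k) → ℝ) → Fin B → ℝ) :=
  measurable_pi_lambda _ fun _ => measurable_pi_apply _

/-- The fibre point is a measurable function of `z`. -/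
theorem measurable_fibPt : Measurable (fibPt : (Fin (B + k) → ℝ) → Fin k → ℝ) :=
  measurable_pi_lambda _ fun _ => measurable_pi_apply _

/-- The literal letter block is measurable. -/
theorem measurable_rblock (a : Fin k → Option (Atm B)) :
    Measurable (rblock a : (Fin (B + k) → ℝ) → ℝ) := by
  unfold rblock
  refine Finset.measurable_prod _ fun i _ => ?_
  rcases a i with _ | c
  · exact measurable_const
  · simp only [Option.elim_some, one_div]
    exact (((measurable_pi_apply i).comp measurable_fibPt).sub
      ((measurable_av c).comp measurable_basePt)).inv

/-- A function agreeing with `R(base) · rblock` on the literal domain is a.e. strongly measurable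
there. -/
theorem aestronglyMeasurable_of_eqOn_fdom {Y : Set (Fin B → ℝ)} (hY : MeasurableSet Y)
    (lo hi : Fin k → Fin k ⊕ Atm B) (a : Fin k → Option (Atm B)) {R : (Fin B → ℝ) → ℝ}
    (hR : Measurable R) {f : (Fin (B + k) → ℝ) → ℝ}
    (hf : EqOn f (fun z => R (basePt z) * rblock a z) (fdom Y lo hi)) :
    AEStronglyMeasurable f (volume.restrict (fdom Y lo hi)) := by
  have hm : Measurable fun z : Fin (B + k) → ℝ => R (basePt z) * rblock a z :=
    (hR.comp measurable_basePt).mul (measurable_rblock a)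
  refine hm.aestronglyMeasurable.congr ?_
  filter_upwards [ae_restrict_mem (measurableSet_fdom hY lo hi)] with z hz
  exact (hf hz).symm

/-- **Absolute integrability from a finite base integral of `|R| · lmass`.** -/
theorem integrableOn_of_lintegral_lt_top {Y : Set (Fin B → ℝ)} (hY : MeasurableSet Y)
    (lo hi : Fin k → Fin k ⊕ Atm B) (a : Fin k → Option (Atm B)) {R : (Fin B → ℝ) → ℝ}
    (hR : Measurable R) {f : (Fin (B + k) → ℝ) → ℝ}
    (hf : EqOn f (fun z => R (basePt z) * rblock a z) (fdom Y lo hi))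
    (hfin : ∫⁻ x in Y, ENNReal.ofReal |R x| * lmass lo hi a (av x) < ∞) :
    IntegrableOn f (fdom Y lo hi) :=
  (integrableOn_fdom_iff hY lo hi a R hR f hf (aestronglyMeasurable_of_eqOn_fdom hY lo hi a hR hf)).2
    hfin

end SepTwo

/-- **Absolute integrability of a literal Janus band integrand from the fibre mass** (registered
sub-goal of `stub_separateTwo`; literal form of `SepTwo.integrableOn_of_lintegral_lt_top`): a
function agreeing on the literal domain with `R(base) · (letter block)`, `R` measurable, is
absolutely integrable there as soon as the base integral of `|R| · lmass` is finite. -/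
theorem separateTwo_meas (B k m' : ℕ) (M : Fin m' → (Fin B → ℚ) × ℚ) (lo hi : Fin k → Fin k ⊕ ((Fin B → ℚ) × ℚ)) (a : Fin k → Option ((Fin B → ℚ) × ℚ)) (R : (Fin B → ℝ) → ℝ) (hR : Measurable R) (f : (Fin (B + k) → ℝ) → ℝ) (hf : Set.EqOn f (fun z => R (fun i => z (Fin.castAdd k i)) * ∏ i, (a i).elim 1 (fun c => 1 / (z (Fin.natAdd B i) - (∑ i', (c.1 i' : ℝ) * z (Fin.castAdd k i') + (c.2 : ℝ))))) {z : Fin (B + k) → ℝ | (∀ j, 0 < ∑ i, ((M j).1 i : ℝ) * z (Fin.castAdd k i) + ((M j).2 : ℝ)) ∧ ∀ i, Sum.elim (fun j => z (Fin.natAdd B j)) (fun c => ∑ i', (c.1 i' : ℝ) * z (Fin.castAdd k i') + (c.2 : ℝ)) (lo i) < z (Fin.natAdd B i) ∧ z (Fin.natAdd B i) < Sum.elim (fun j => z (Fin.natAdd B j)) (fun c => ∑ i', (c.1 i' : ℝ) * z (Fin.castAdd k i') + (c.2 : ℝ)) (hi i)}) (hfin : MeasureTheory.lintegral (MeasureTheory.volume.restrict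 {x : Fin B → ℝ | ∀ j, 0 < ∑ i, ((M j).1 i : ℝ) * x i + ((M j).2 : ℝ)}) (fun x => ENNReal.ofReal |R x| * SepTwo.lmass lo hi a (fun c : (Fin B → ℚ) × ℚ => ∑ i, (c.1 i : ℝ) * x i + (c.2 : ℝ))) < ⊤) : MeasureTheory.IntegrableOn f {z : Fin (B + k) → ℝ | (∀ j, 0 < ∑ i, ((M j).1 i : ℝ) * z (Fin.castAdd k i) + ((M j).2 : ℝ)) ∧ ∀ i, Sum.elim (fun j => z (Fin.natAdd B j)) (fun c => ∑ i', (c.1 i' : ℝ) * z (Fin.castAdd k i') + (c.2 : ℝ)) (lo i) < z (Fin.natAdd B i) ∧ z (Fin.natAdd B i) < Sum.elim (fun j => z (Fin.natAdd B j)) (fun c => ∑ i', (c.1 i' : ℝ) * z (Fin.castAdd k i') + (c.2 : ℝ)) (hi i)} MeasureTheory.volume := by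
  have hY : MeasurableSet {x : Fin B → ℝ | ∀ j, 0 < SepTwo.av x (M j)} := by
    have : {x : Fin B → ℝ | ∀ j, 0 < SepTwo.av x (M j)} = ⋂ j, {x | 0 < SepTwo.av x (M j)} := by
      ext x; simp
    rw [this]
    exact MeasurableSet.iInter fun j => measurableSet_lt measurable_const (SepTwo.measurable_av _)
  exact SepTwo.integrableOn_of_lintegral_lt_top hY lo hi a hR hf hfin

end Summit.KontsevichZagierPeriods.ArrangementNormalForm.JanusBands
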